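import Summits.Ventures.DiscreteObjects.UnitDistance.AtlasKillerValues
import Summits.Ventures.DiscreteObjects.UnitDistance.UnitQuadranceF243Hoffman
import HarnessLib

/-!
# The kernel rows of the (U) residue-field atlas, with the prime power `q = 243` — one statement

Framing (verbatim for the cell): lottery ticket; floor = certified bounds/negative ranges.

`AtlasKillerValues.lean` (udg g7) records the kernel-exact part of the order-1 residue-field atlas of target (U): the four killer values
`χ(UD(F₃²)) = 3`, `χ(UD(F₇²)) = 4`, `χ(UD(F₁₁²)) = 5`, `χ(UD(F₁₉²)) = 5` and `5 ≤ χ ≤ 7` at the open field `q = 27`.  This file adds the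
row `q = 243 = 3⁵` — `χ(unitCircleGraph F) ≥ 10` for every field with 243 elements, from the elementary Hoffman bound for Cayley graphs of
lines (`LineCayleyHoffman.lean`, `UnitQuadranceF243Hoffman.lean`: `α ≤ 6272`) — so that the residue fields of characteristic 3 that the
reduction can meet below `3⁷` (`q = 3, 27, 243`; `q ≡ 3 (mod 4)` forces an odd power) are all covered by ONE kernel theorem.  Not kernel
(certificates / exact spectra outside Lean, or print): `χ ≥ 6` for `p = 23, 31, 43, 47`, `q = 343`, and all `q ≥ 67` other than `243`.  Seat udg g8.
-/

namespace Summit.Ventures.DiscreteObjects.UnitDistance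

open SimpleGraph

/-- RESIDUE-FIELD ATLAS, KERNEL ROWS: `χ(UD(F₃²)) = 3`, `χ(UD(F₇²)) = 4`, `χ(UD(F₁₁²)) = 5`, `χ(UD(F₁₉²)) = 5`; `5 ≤ χ(UD(F²)) ≤ 7` for
`|F| = 27`; `10 ≤ χ(UD(F²))` for `|F| = 243`.  In the census vocabulary: `F₃, F₇, F₁₁, F₁₉` are killer residue fields, `F₂₄₃` is not,
`F₂₇` is undecided (`χ ∈ {5, 6, 7}`). -/
theorem atlas_residue_fields_kernel :
    (unitCircleGraph (ZMod 3)).chromaticNumber = 3 ∧ (unitCircleGraph (ZMod 7)).chromaticNumber = 4 ∧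
      (unitCircleGraph (ZMod 11)).chromaticNumber = 5 ∧ (unitCircleGraph (ZMod 19)).chromaticNumber = 5 ∧
      (∀ (F : Type) [Field F] [Fintype F], Fintype.card F = 27 →
        (5 : ℕ∞) ≤ (unitCircleGraph F).chromaticNumber ∧ (unitCircleGraph F).chromaticNumber ≤ 7) ∧
      ∀ (F : Type) [Field F] [Fintype F], Fintype.card F = 243 → (10 : ℕ∞) ≤ (unitCircleGraph F).chromaticNumber :=
  ⟨atlas_killer_values_kernel.1, atlas_killer_values_kernel.2.1, atlas_killer_values_kernel.2.2.1, atlas_killer_values_kernel.2.2.2.1,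
    atlas_killer_values_kernel.2.2.2.2, fun F _ _ hF => ten_le_chromaticNumber_unitCircleGraph_of_card_eq_243 F hF⟩

/-- The non-killer half in the census vocabulary: a residue field with 243 elements puts NO 5-colour constraint on unit-distance graphs —
its own unit-circle graph is not even 9-colourable. -/
theorem not_colorable_nine_unitCircleGraph_of_card_eq_243 (F : Type*) [Field F] [Fintype F] (hF : Fintype.card F = 243) :
    ¬ (unitCircleGraph F).Colorable 9 := by
  intro h
  have h10 := ten_le_chromaticNumber_unitCircleGraph_of_card_eq_243 F hF
  have h9 : (unitCircleGraph F).chromaticNumber ≤ 9 := h.chromaticNumber_le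
  have : (10 : ℕ∞) ≤ 9 := h10.trans h9
  exact absurd this (by decide)

end Summit.Ventures.DiscreteObjects.UnitDistance
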